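import Literature.Analysis.PDE.SobolevHighLow
import Literature.Analysis.PDE.ParabolicJointSmoothness
import Mathlib.Analysis.Calculus.MeanValue
import HarnessLib

/-!
# Composition estimates for jets: sup, high–low `L²`, and pointwise differences
# (topic `Analysis/PDE`)

Analytic layer (III), step 4b, of the programme to prove short-time existence for quasilinear
strictly parabolic systems on a closed manifold (hypothesis `hQL` of
`Literature.Geometry.Riemannian.ricciFlow_shortTime_existence_of_quasilinear`). The coefficients
of the quasilinear operator enter the frozen Picard scheme through composites
`y ↦ G(y, 𝔷(y))` of a smooth compactly supported `G : E' × 𝒥 → V` (a cut-off coefficient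
function of the point and the jet) with the jet field `𝔷` of an iterate. This file proves the
three estimates the scheme needs, by induction on the order from the chain rule
`∂ᵥ(G∘(id, 𝔷)) = G^{(v,0)}∘(id, 𝔷) + Σ_k (∂ᵥ𝔷)_k • G^{(0,b_k)}∘(id, 𝔷)` in frame form (all terms
of the same type as `G`, so that the induction runs at fixed types; no Faà di Bruno formula):

* `norm_iteratedFDeriv_jetComp_le` — **sup bounds**: with `‖Dᵐ𝔷‖ ≤ R` (`m ≤ j`), all
  `‖Dᵐ(G∘(id, 𝔷))‖` (`m ≤ j`) are bounded by a constant depending on `G, j, R` only;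
* `sobolevEnergy_jetComp_le` — **high–low `L²` bounds**: with `‖Dᵐ𝔷‖ ≤ R` only for
  `m ≤ j/2 + 1`, `E_i(G∘(id, 𝔷)) ≤ C (1 + Σ_{m≤i} E_m(𝔷))` for `i ≤ j`
  (from `sobolevEnergy_bilinear_highlow`);
* `norm_iteratedFDeriv_jetComp_sub_le` — **pointwise differences**: with `‖Dᵐ𝔷‖, ‖Dᵐ𝔷'‖ ≤ R`
  (`m ≤ j`), `‖Dⁱ(G∘(id, 𝔷) - G∘(id, 𝔷'))(y)‖ ≤ C Σ_{m≤i} ‖Dᵐ(𝔷 - 𝔷')(y)‖` (`i ≤ j`),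
  by the mean value inequality.

Everything is proved; no named fact and no `sorry` is introduced.

## References

* M. E. Taylor, *Partial Differential Equations III*, 2nd ed., Springer 2011, Ch. 13, §3,
  Prop. 3.9 (Moser-type composition estimates). [TaylorPDEIII2011]
* L. Hörmander, *The Analysis of Linear Partial Differential Operators I*, Springer 1983,
  Thm. 1.1.7. [HormanderALPDO1]
-/

noncomputable section

open MeasureTheory Set Function Filter
open scoped ENNReal ContDiff

namespace Literature.Analysis.PDE

open Literature.Analysis.FunctionSpaces

section Defs

variable {E' 𝒥 V : Type*}

/-! ### Composites with jets -/

/-- **The composite of a coefficient function with a jet field**: `(G∘(id, 𝔷))(y) = G(y, 𝔷(y))`.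
[cite: TaylorPDEIII2011, Ch. 13, §3] -/
def jetComp (G : E' × 𝒥 → V) (𝔷 : E' → 𝒥) (y : E') : V := G (y, 𝔷 y)

/-- `jetComp_apply`: unfolding. [folklore] -/
@[simp] theorem jetComp_apply (G : E' × 𝒥 → V) (𝔷 : E' → 𝒥) (y : E') : jetComp G 𝔷 y = G (y, 𝔷 y) := rfl

end Defs

variable {E' : Type*} [NormedAddCommGroup E'] [InnerProductSpace ℝ E'] [FiniteDimensional ℝ E']
variable {𝒥 : Type*} [NormedAddCommGroup 𝒥] [NormedSpace ℝ 𝒥] [FiniteDimensional ℝ 𝒥]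
variable {V : Type*} [NormedAddCommGroup V] [NormedSpace ℝ V]

/-! ### Jet coordinates and the partial derivatives of `G` in frame form -/

/-- A basis of the jet space. [folklore] -/
def jb (𝒥 : Type*) [NormedAddCommGroup 𝒥] [NormedSpace ℝ 𝒥] [FiniteDimensional ℝ 𝒥] :
    Module.Basis (Fin (Module.finrank ℝ 𝒥)) ℝ 𝒥 := Module.finBasis ℝ 𝒥

/-- The coordinate functionals of the jet basis (continuous). [folklore] -/
def jcoord (k : Fin (Module.finrank ℝ 𝒥)) : 𝒥 →L[ℝ] ℝ := LinearMap.toContinuousLinearMap ((jb 𝒥).coord k)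

omit [FiniteDimensional ℝ E'] in
/-- Expansion in the jet basis: `x = Σ_k x_k • b_k`. [folklore] -/
theorem sum_jcoord_smul (x : 𝒥) : ∑ k, jcoord k x • jb 𝒥 k = x := by
  have h := (jb 𝒥).sum_repr x
  simp only [jcoord, LinearMap.coe_toContinuousLinearMap', Module.Basis.coord_apply]
  exact h

/-- The partial derivative of `G` in the point, direction `v`. [folklore] -/
def GDv (G : E' × 𝒥 → V) (v : E') (p : E' × 𝒥) : V := fderiv ℝ G p (v, 0)

/-- The partial derivative of `G` in the jet, basis direction `b_k`. [folklore] -/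
def GDk (G : E' × 𝒥 → V) (k : Fin (Module.finrank ℝ 𝒥)) (p : E' × 𝒥) : V := fderiv ℝ G p (0, jb 𝒥 k)

omit [FiniteDimensional ℝ E'] [FiniteDimensional ℝ 𝒥] in
/-- A composite of smooth maps is smooth. [folklore] -/
theorem contDiff_jetComp {G : E' × 𝒥 → V} (hG : ContDiff ℝ ∞ G) {𝔷 : E' → 𝒥} (h𝔷 : ContDiff ℝ ∞ 𝔷) :
    ContDiff ℝ ∞ (jetComp G 𝔷) := hG.comp (contDiff_id.prodMk h𝔷)

omit [FiniteDimensional ℝ E'] [FiniteDimensional ℝ 𝒥] in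
/-- `GDv` of a smooth `G` is smooth. [folklore] -/
theorem contDiff_GDv {G : E' × 𝒥 → V} (hG : ContDiff ℝ ∞ G) (v : E') : ContDiff ℝ ∞ (GDv G v) :=
  (hG.fderiv_right (m := ∞) (by norm_cast)).clm_apply contDiff_const

omit [FiniteDimensional ℝ E'] in
/-- `GDk` of a smooth `G` is smooth. [folklore] -/
theorem contDiff_GDk {G : E' × 𝒥 → V} (hG : ContDiff ℝ ∞ G) (k : Fin (Module.finrank ℝ 𝒥)) : ContDiff ℝ ∞ (GDk G k) :=
  (hG.fderiv_right (m := ∞) (by norm_cast)).clm_apply contDiff_const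

omit [FiniteDimensional ℝ E'] [FiniteDimensional ℝ 𝒥] in
/-- `GDv` of a compactly supported `G` is compactly supported. [folklore] -/
theorem hasCompactSupport_GDv {G : E' × 𝒥 → V} (hGc : HasCompactSupport G) (v : E') : HasCompactSupport (GDv G v) :=
  hGc.fderiv_apply (𝕜 := ℝ) _

omit [FiniteDimensional ℝ E'] in
/-- `GDk` of a compactly supported `G` is compactly supported. [folklore] -/
theorem hasCompactSupport_GDk {G : E' × 𝒥 → V} (hGc : HasCompactSupport G) (k : Fin (Module.finrank ℝ 𝒥)) :
    HasCompactSupport (GDk G k) :=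
  hGc.fderiv_apply (𝕜 := ℝ) _

omit [InnerProductSpace ℝ E'] [FiniteDimensional ℝ E'] [NormedSpace ℝ 𝒥] [FiniteDimensional ℝ 𝒥] [NormedSpace ℝ V] in
/-- A composite with a compactly supported `G` is compactly supported (its support projects into
the compact point-projection of the support of `G`). [folklore] -/
theorem hasCompactSupport_jetComp [NormedSpace ℝ E'] {G : E' × 𝒥 → V} (hGc : HasCompactSupport G) (𝔷 : E' → 𝒥) :
    HasCompactSupport (jetComp G 𝔷) := by
  refine HasCompactSupport.of_support_subset_isCompact (hGc.image continuous_fst) fun y hy ↦ ?_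
  exact ⟨(y, 𝔷 y), subset_tsupport _ (by simpa [jetComp] using hy), rfl⟩

omit [FiniteDimensional ℝ E'] in
/-- **The chain rule for composites, frame form**:
`∂ᵥ(G∘(id, 𝔷))(y) = G^{(v,0)}(y, 𝔷 y) + Σ_k (∂ᵥ𝔷(y))_k • G^{(0,b_k)}(y, 𝔷 y)`. [folklore] -/
theorem fderiv_jetComp_apply {G : E' × 𝒥 → V} (hG : ContDiff ℝ ∞ G) {𝔷 : E' → 𝒥} (h𝔷 : ContDiff ℝ ∞ 𝔷) (y v : E') :
    fderiv ℝ (jetComp G 𝔷) y v = jetComp (GDv G v) 𝔷 y + ∑ k, jcoord k (fderiv ℝ 𝔷 y v) • jetComp (GDk G k) 𝔷 y := by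
  have h1 : HasFDerivAt (fun y ↦ (y, 𝔷 y)) ((ContinuousLinearMap.id ℝ E').prod (fderiv ℝ 𝔷 y)) y :=
    (hasFDerivAt_id y).prodMk ((h𝔷.differentiable (by simp)) y).hasFDerivAt
  have h2 : HasFDerivAt (jetComp G 𝔷) (fderiv ℝ G (y, 𝔷 y) ∘L (ContinuousLinearMap.id ℝ E').prod (fderiv ℝ 𝔷 y)) y :=
    ((hG.differentiable (by simp)) _).hasFDerivAt.comp y h1
  rw [h2.fderiv]
  simp only [ContinuousLinearMap.coe_comp, Function.comp_apply, ContinuousLinearMap.prod_apply, ContinuousLinearMap.coe_id', id_eq,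
    jetComp_apply, GDv, GDk]
  have hsplit : ((v, fderiv ℝ 𝔷 y v) : E' × 𝒥) = (v, 0) + ∑ k, jcoord k (fderiv ℝ 𝔷 y v) • ((0, jb 𝒥 k) : E' × 𝒥) := by
    have h := sum_jcoord_smul (fderiv ℝ 𝔷 y v)
    ext
    · simp [Prod.fst_sum]
    · simp only [Prod.snd_add, Prod.snd_sum, Prod.smul_snd, zero_add]
      exact h.symm
  rw [hsplit, map_add, map_sum]
  simp only [map_smul]

/-! ### Sup bounds -/

/-- A continuous compactly supported function is bounded. [folklore] -/
theorem exists_bound_of_hasCompactSupport {W : Type*} [NormedAddCommGroup W] {X : Type*} [TopologicalSpace X]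
    {F : X → W} (hF : Continuous F) (hFc : HasCompactSupport F) : ∃ C, 0 ≤ C ∧ ∀ x, ‖F x‖ ≤ C := by
  obtain ⟨C, hC⟩ := hF.norm.bddAbove_range_of_hasCompactSupport hFc.norm
  exact ⟨max C 0, le_max_right _ _, fun x ↦ (hC ⟨x, rfl⟩).trans (le_max_left _ _)⟩

omit [FiniteDimensional ℝ 𝒥] in
/-- The embedding `w ↦ ⟪b_a, ·⟫ ⊗ w` has norm `≤ 1`. [folklore] -/
theorem norm_smulRightL_innerSL_le' (a : Fin (Module.finrank ℝ E')) :
    ‖ContinuousLinearMap.smulRightL ℝ E' V (innerSL ℝ (stdOrthonormalBasis ℝ E' a))‖ ≤ 1 := by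
  refine ContinuousLinearMap.opNorm_le_bound _ zero_le_one fun w ↦ ?_
  rw [one_mul, ContinuousLinearMap.smulRightL_apply_apply]
  refine ContinuousLinearMap.opNorm_le_bound _ (norm_nonneg _) fun x ↦ ?_
  rw [ContinuousLinearMap.smulRight_apply, norm_smul, mul_comm]
  refine mul_le_mul_of_nonneg_left ?_ (norm_nonneg _)
  refine (ContinuousLinearMap.le_opNorm _ _).trans ?_
  rw [innerSL_apply_norm, (stdOrthonormalBasis ℝ E').orthonormal.1 a, one_mul]

/-- Iterated derivatives of a map through its frame derivatives:
`‖Dʲ(Df)(y)‖ ≤ Σ_a ‖Dʲ(∂_a f)(y)‖`. [folklore] -/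
theorem norm_iteratedFDeriv_fderiv_le_sum {f : E' → V} (hf : ContDiff ℝ ∞ f) (j : ℕ) (y : E') :
    ‖iteratedFDeriv ℝ (j + 1) f y‖ ≤ ∑ a, ‖iteratedFDeriv ℝ j (fun x ↦ fderiv ℝ f x (stdOrthonormalBasis ℝ E' a)) y‖ := by
  set e := stdOrthonormalBasis ℝ E' with he
  rw [← norm_iteratedFDeriv_fderiv]
  set F : Fin (Module.finrank ℝ E') → E' → V := fun a x ↦ fderiv ℝ f x (e a) with hFdef
  have hF : ∀ a, ContDiff ℝ ∞ (F a) := fun a ↦ (hf.fderiv_right (m := ∞) (by norm_cast)).clm_apply contDiff_const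
  have hfun : fderiv ℝ f = fun x ↦ ∑ a, (ContinuousLinearMap.smulRightL ℝ E' V (innerSL ℝ (e a))) (F a x) := by
    funext x
    exact (ParabolicTower.fderiv_eq_sum_smulRight x).trans (Finset.sum_congr rfl fun a _ ↦ rfl)
  have hT : ∀ a, ContDiff ℝ j fun x ↦ (ContinuousLinearMap.smulRightL ℝ E' V (innerSL ℝ (e a))) (F a x) := fun a ↦
    (contDiff_const.clm_apply (hF a)).of_le (by exact_mod_cast le_top)
  nth_rewrite 1 [hfun]
  rw [iteratedFDeriv_sum (fun a _ ↦ hT a), Finset.sum_apply]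
  refine (norm_sum_le _ _).trans (Finset.sum_le_sum fun a _ ↦ ?_)
  have h := (ContinuousLinearMap.smulRightL ℝ E' V (innerSL ℝ (e a))).norm_iteratedFDeriv_comp_left (f := F a) (x := y)
    (N := ∞) (n := j) (hF a).contDiffAt (by exact_mod_cast le_top)
  refine h.trans ?_
  calc _ ≤ 1 * ‖iteratedFDeriv ℝ j (F a) y‖ := mul_le_mul_of_nonneg_right (norm_smulRightL_innerSL_le' a) (norm_nonneg _)
    _ = _ := one_mul _

/-- **Sup bounds for composites**: for smooth compactly supported `G`, every order `j` and every
`R` there is `C ≥ 0` such that `‖Dᵐ(G∘(id, 𝔷))(y)‖ ≤ C` for all `m ≤ j`, all `y`, and all smooth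
`𝔷` with `‖Dᵐ𝔷‖ ≤ R` (`m ≤ j`) everywhere. [cite: TaylorPDEIII2011, Ch. 13, Prop. 3.9] -/
theorem norm_iteratedFDeriv_jetComp_le :
    ∀ (j : ℕ) {G : E' × 𝒥 → V}, ContDiff ℝ ∞ G → HasCompactSupport G → ∀ R : ℝ,
      ∃ C : ℝ, 0 ≤ C ∧ ∀ {𝔷 : E' → 𝒥}, ContDiff ℝ ∞ 𝔷 → (∀ m ≤ j, ∀ y, ‖iteratedFDeriv ℝ m 𝔷 y‖ ≤ R) →
        ∀ m ≤ j, ∀ y, ‖iteratedFDeriv ℝ m (jetComp G 𝔷) y‖ ≤ C := by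
  intro j
  induction j with
  | zero =>
    intro G hG hGc R
    obtain ⟨C, hC0, hC⟩ := exists_bound_of_hasCompactSupport hG.continuous hGc
    refine ⟨C, hC0, fun {𝔷} _ _ m hm y ↦ ?_⟩
    obtain rfl : m = 0 := by omega
    rw [norm_iteratedFDeriv_zero]
    exact hC _
  | succ j ih =>
    intro G hG hGc R
    set e := stdOrthonormalBasis ℝ E' with he
    -- constants for `G`, `G^{(e_a, 0)}`, `G^{(0, b_k)}` at order `j`
    obtain ⟨C₀, hC₀0, hC₀⟩ := ih hG hGc R
    have h1 := fun a ↦ ih (contDiff_GDv hG (e a)) (hasCompactSupport_GDv hGc (e a)) R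
    have h2 := fun k ↦ ih (contDiff_GDk hG k) (hasCompactSupport_GDk hGc k) R
    choose C₁ hC₁0 hC₁ using h1
    choose C₂ hC₂0 hC₂ using h2
    set L : ℝ := ∑ k : Fin (Module.finrank ℝ 𝒥), ‖(jcoord k : 𝒥 →L[ℝ] ℝ)‖ * C₂ k with hL
    have hL0 : 0 ≤ L := Finset.sum_nonneg fun k _ ↦ mul_nonneg (norm_nonneg _) (hC₂0 k)
    have hnn : 0 ≤ ∑ a : Fin (Module.finrank ℝ E'), (C₁ a + 2 ^ j * |R| * L) := Finset.sum_nonneg fun a _ ↦ add_nonneg (hC₁0 a) (by positivity)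
    refine ⟨C₀ + ∑ a : Fin (Module.finrank ℝ E'), (C₁ a + 2 ^ j * |R| * L), add_nonneg hC₀0 hnn, fun {𝔷} h𝔷 hR m hm y ↦ ?_⟩
    rcases Nat.lt_or_ge m (j + 1) with hmj | hmj
    · exact (hC₀ h𝔷 (fun m hm y ↦ hR m (by omega) y) m (by omega) y).trans (le_add_of_nonneg_right hnn)
    obtain rfl : m = j + 1 := by omega
    have hc : ContDiff ℝ ∞ (jetComp G 𝔷) := contDiff_jetComp hG h𝔷
    refine (norm_iteratedFDeriv_fderiv_le_sum hc j y).trans ((Finset.sum_le_sum fun a _ ↦ ?_).trans (le_add_of_nonneg_left hC₀0))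
    -- the frame derivative `∂_a (G∘(id,𝔷))`
    have hR' : ∀ m ≤ j, ∀ y, ‖iteratedFDeriv ℝ m 𝔷 y‖ ≤ R := fun m hm y ↦ hR m (by omega) y
    have hfun : (fun x ↦ fderiv ℝ (jetComp G 𝔷) x (e a)) = fun x ↦ jetComp (GDv G (e a)) 𝔷 x +
        ∑ k, jcoord k (fderiv ℝ 𝔷 x (e a)) • jetComp (GDk G k) 𝔷 x := funext fun x ↦ fderiv_jetComp_apply hG h𝔷 x _
    rw [hfun]
    have hA : ContDiff ℝ ∞ (jetComp (GDv G (e a)) 𝔷) := contDiff_jetComp (contDiff_GDv hG _) h𝔷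
    have hφ : ∀ k, ContDiff ℝ ∞ fun x ↦ jcoord k (fderiv ℝ 𝔷 x (e a)) := fun k ↦
      (jcoord k).contDiff.comp ((h𝔷.fderiv_right (m := ∞) (by norm_cast)).clm_apply contDiff_const)
    have hψ : ∀ k, ContDiff ℝ ∞ (jetComp (GDk G k) 𝔷) := fun k ↦ contDiff_jetComp (contDiff_GDk hG _) h𝔷
    have hS : ContDiff ℝ ∞ fun x ↦ ∑ k, jcoord k (fderiv ℝ 𝔷 x (e a)) • jetComp (GDk G k) 𝔷 x := ContDiff.sum fun k _ ↦ (hφ k).smul (hψ k)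
    rw [fun_iteratedFDeriv_add_apply (hA.contDiffAt.of_le (by exact_mod_cast le_top)) (hS.contDiffAt.of_le (by exact_mod_cast le_top))]
    refine (norm_add_le _ _).trans (add_le_add (hC₁ a h𝔷 hR' j le_rfl y) ?_)
    have hS' : ∀ k, ContDiff ℝ j fun x ↦ jcoord k (fderiv ℝ 𝔷 x (e a)) • jetComp (GDk G k) 𝔷 x := fun k ↦
      ((hφ k).smul (hψ k)).of_le (by exact_mod_cast le_top)
    rw [iteratedFDeriv_sum (fun k _ ↦ hS' k), Finset.sum_apply]
    refine (norm_sum_le _ _).trans ?_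
    rw [hL, Finset.mul_sum]
    refine Finset.sum_le_sum fun k _ ↦ ?_
    refine (norm_iteratedFDeriv_smul_le (hφ k) (hψ k) y (n := j) (by exact_mod_cast le_top)).trans ?_
    -- bound the coefficient derivatives: `‖D^i (x ↦ (∂_a 𝔷 x)_k)‖ ≤ ‖jcoord k‖ R`
    have hφb : ∀ i ≤ j, ‖iteratedFDeriv ℝ i (fun x ↦ jcoord k (fderiv ℝ 𝔷 x (e a))) y‖ ≤ ‖(jcoord k : 𝒥 →L[ℝ] ℝ)‖ * |R| := by
      intro i hi
      have h := (jcoord k).norm_iteratedFDeriv_comp_left (f := fun x ↦ fderiv ℝ 𝔷 x (e a)) (x := y) (N := ∞) (n := i)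
        (((h𝔷.fderiv_right (m := ∞) (by norm_cast)).clm_apply contDiff_const).contDiffAt) (by exact_mod_cast le_top)
      refine h.trans (mul_le_mul_of_nonneg_left ?_ (norm_nonneg _))
      exact (norm_iteratedFDeriv_fderiv_frame_le h𝔷 i a y).trans ((hR (i + 1) (by omega) y).trans (le_abs_self R))
    calc ∑ i ∈ Finset.range (j + 1), (j.choose i : ℝ) * ‖iteratedFDeriv ℝ i (fun x ↦ jcoord k (fderiv ℝ 𝔷 x (e a))) y‖ *
          ‖iteratedFDeriv ℝ (j - i) (jetComp (GDk G k) 𝔷) y‖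
        ≤ ∑ i ∈ Finset.range (j + 1), (j.choose i : ℝ) * (‖(jcoord k : 𝒥 →L[ℝ] ℝ)‖ * |R|) * C₂ k := by
          refine Finset.sum_le_sum fun i hi ↦ ?_
          have hi' : i ≤ j := Nat.lt_succ_iff.1 (Finset.mem_range.1 hi)
          exact mul_le_mul (mul_le_mul_of_nonneg_left (hφb i hi') (Nat.cast_nonneg _)) (hC₂ k h𝔷 hR' (j - i) (by omega) y)
            (norm_nonneg _) (mul_nonneg (Nat.cast_nonneg _) (mul_nonneg (norm_nonneg _) (abs_nonneg _)))
      _ = 2 ^ j * |R| * (‖(jcoord k : 𝒥 →L[ℝ] ℝ)‖ * C₂ k) := by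
          rw [← Finset.sum_mul, ← Finset.sum_mul]
          have h := Nat.sum_range_choose j
          have h' : ∑ i ∈ Finset.range (j + 1), (j.choose i : ℝ) = 2 ^ j := by exact_mod_cast h
          rw [h']; ring

/-! ### Pointwise bounds for differences of composites -/

omit [FiniteDimensional ℝ E'] [FiniteDimensional ℝ 𝒥] in
/-- **Lipschitz bound in the jet** (mean value inequality): `‖G(y, J) - G(y, J')‖ ≤ M ‖J - J'‖`
with `M` a bound of `‖DG‖`. [cite: HormanderALPDO1, Thm. 1.1.7] -/
theorem norm_jetComp_sub_le_of_fderiv_le {G : E' × 𝒥 → V} (hG : ContDiff ℝ ∞ G) {M : ℝ} (hM : ∀ p, ‖fderiv ℝ G p‖ ≤ M)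
    (y : E') (J J' : 𝒥) : ‖G (y, J) - G (y, J')‖ ≤ M * ‖J - J'‖ := by
  have hd : ∀ J ∈ (univ : Set 𝒥), DifferentiableAt ℝ (fun J ↦ G (y, J)) J := fun J _ ↦
    ((hG.differentiable (by simp)) _).comp J ((differentiableAt_const _).prodMk differentiableAt_id)
  have hb : ∀ J ∈ (univ : Set 𝒥), ‖fderiv ℝ (fun J ↦ G (y, J)) J‖ ≤ M := by
    intro J _
    have h1 : HasFDerivAt (fun J ↦ ((y, J) : E' × 𝒥)) (ContinuousLinearMap.inr ℝ E' 𝒥) J := (hasFDerivAt_const y J).prodMk (hasFDerivAt_id J)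
    have h2 : HasFDerivAt (fun J ↦ G (y, J)) (fderiv ℝ G (y, J) ∘L ContinuousLinearMap.inr ℝ E' 𝒥) J :=
      ((hG.differentiable (by simp)) (y, J)).hasFDerivAt.comp J h1
    rw [h2.fderiv]
    refine (ContinuousLinearMap.opNorm_comp_le _ _).trans ?_
    calc ‖fderiv ℝ G (y, J)‖ * ‖ContinuousLinearMap.inr ℝ E' 𝒥‖ ≤ M * 1 :=
          mul_le_mul (hM _) (ContinuousLinearMap.norm_inr_le_one ℝ E' 𝒥) (norm_nonneg (ContinuousLinearMap.inr ℝ E' 𝒥))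
            ((norm_nonneg (fderiv ℝ G (y, J))).trans (hM (y, J)))
      _ = M := mul_one M
  exact (convex_univ.norm_image_sub_le_of_norm_fderiv_le hd hb (mem_univ J') (mem_univ J))

/-- **Pointwise bounds for differences of composites**: for smooth compactly supported `G`, every
order `j` and every `R` there is `C ≥ 0` such that for all smooth `𝔷, 𝔷'` with
`‖Dᵐ𝔷‖, ‖Dᵐ𝔷'‖ ≤ R` (`m ≤ j`), all `i ≤ j` and all `y`:
`‖Dⁱ(G∘(id, 𝔷) - G∘(id, 𝔷'))(y)‖ ≤ C Σ_{m≤i} ‖Dᵐ(𝔷 - 𝔷')(y)‖`.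
[cite: TaylorPDEIII2011, Ch. 13, Prop. 3.9] -/
theorem norm_iteratedFDeriv_jetComp_sub_le :
    ∀ (j : ℕ) {G : E' × 𝒥 → V}, ContDiff ℝ ∞ G → HasCompactSupport G → ∀ R : ℝ,
      ∃ C : ℝ, 0 ≤ C ∧ ∀ {𝔷 𝔷' : E' → 𝒥}, ContDiff ℝ ∞ 𝔷 → ContDiff ℝ ∞ 𝔷' →
        (∀ m ≤ j, ∀ y, ‖iteratedFDeriv ℝ m 𝔷 y‖ ≤ R) → (∀ m ≤ j, ∀ y, ‖iteratedFDeriv ℝ m 𝔷' y‖ ≤ R) →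
        ∀ i ≤ j, ∀ y, ‖iteratedFDeriv ℝ i (fun x ↦ jetComp G 𝔷 x - jetComp G 𝔷' x) y‖ ≤
          C * ∑ m ∈ Finset.range (i + 1), ‖iteratedFDeriv ℝ m (fun x ↦ 𝔷 x - 𝔷' x) y‖ := by
  intro j
  induction j with
  | zero =>
    intro G hG hGc R
    obtain ⟨M, hM0, hM⟩ := exists_bound_of_hasCompactSupport ((hG.fderiv_right (m := ∞) (by norm_cast)).continuous) (hGc.fderiv (𝕜 := ℝ))
    refine ⟨M, hM0, fun {𝔷 𝔷'} _ _ _ _ i hi y ↦ ?_⟩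
    obtain rfl : i = 0 := by omega
    simp only [zero_add, Finset.range_one, Finset.sum_singleton, norm_iteratedFDeriv_zero, jetComp_apply]
    exact norm_jetComp_sub_le_of_fderiv_le hG hM y _ _
  | succ j ih =>
    intro G hG hGc R
    set e := stdOrthonormalBasis ℝ E' with he
    obtain ⟨C₀, hC₀0, hC₀⟩ := ih hG hGc R
    have h1 := fun a ↦ ih (contDiff_GDv hG (e a)) (hasCompactSupport_GDv hGc (e a)) R
    have h2 := fun k ↦ ih (contDiff_GDk hG k) (hasCompactSupport_GDk hGc k) R
    have h3 := fun k ↦ norm_iteratedFDeriv_jetComp_le j (contDiff_GDk hG k) (hasCompactSupport_GDk hGc k) R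
    choose C₁ hC₁0 hC₁ using h1
    choose C₂ hC₂0 hC₂ using h2
    choose C₃ hC₃0 hC₃ using h3
    set L : ℝ := ∑ k : Fin (Module.finrank ℝ 𝒥), ‖(jcoord k : 𝒥 →L[ℝ] ℝ)‖ * (2 ^ j * C₃ k + 2 ^ j * |R| * C₂ k) with hL
    have hL0 : 0 ≤ L := Finset.sum_nonneg fun k _ ↦ by have := hC₃0 k; have := hC₂0 k; positivity
    have hnn : 0 ≤ ∑ a : Fin (Module.finrank ℝ E'), (C₁ a + L) := Finset.sum_nonneg fun a _ ↦ add_nonneg (hC₁0 a) hL0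
    refine ⟨C₀ + ∑ a : Fin (Module.finrank ℝ E'), (C₁ a + L), add_nonneg hC₀0 hnn, fun {𝔷 𝔷'} h𝔷 h𝔷' hR hR' i hi y ↦ ?_⟩
    set S : ℝ := ∑ m ∈ Finset.range (i + 1), ‖iteratedFDeriv ℝ m (fun x ↦ 𝔷 x - 𝔷' x) y‖ with hS
    have hS0 : 0 ≤ S := Finset.sum_nonneg fun m _ ↦ norm_nonneg _
    have hRj : ∀ m ≤ j, ∀ y, ‖iteratedFDeriv ℝ m 𝔷 y‖ ≤ R := fun m hm y ↦ hR m (by omega) y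
    have hRj' : ∀ m ≤ j, ∀ y, ‖iteratedFDeriv ℝ m 𝔷' y‖ ≤ R := fun m hm y ↦ hR' m (by omega) y
    rcases Nat.lt_or_ge i (j + 1) with hij | hij
    · exact (hC₀ h𝔷 h𝔷' hRj hRj' i (by omega) y).trans (mul_le_mul_of_nonneg_right (le_add_of_nonneg_right hnn) hS0)
    obtain rfl : i = j + 1 := by omega
    -- smoothness of the pieces
    have hd : ContDiff ℝ ∞ fun x ↦ 𝔷 x - 𝔷' x := h𝔷.sub h𝔷'
    have hc : ContDiff ℝ ∞ fun x ↦ jetComp G 𝔷 x - jetComp G 𝔷' x := (contDiff_jetComp hG h𝔷).sub (contDiff_jetComp hG h𝔷')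
    have hφ : ∀ (𝔷 : E' → 𝒥), ContDiff ℝ ∞ 𝔷 → ∀ k a, ContDiff ℝ ∞ fun x ↦ jcoord k (fderiv ℝ 𝔷 x (e a)) := fun 𝔷 h𝔷 k a ↦
      (jcoord k).contDiff.comp ((h𝔷.fderiv_right (m := ∞) (by norm_cast)).clm_apply contDiff_const)
    have hψ : ∀ (𝔷 : E' → 𝒥), ContDiff ℝ ∞ 𝔷 → ∀ k, ContDiff ℝ ∞ (jetComp (GDk G k) 𝔷) := fun 𝔷 h𝔷 k ↦ contDiff_jetComp (contDiff_GDk hG _) h𝔷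
    -- each summand of `S` is at most `S`
    have hterm : ∀ m ≤ j + 1, ‖iteratedFDeriv ℝ m (fun x ↦ 𝔷 x - 𝔷' x) y‖ ≤ S := fun m hm ↦
      Finset.single_le_sum (f := fun m ↦ ‖iteratedFDeriv ℝ m (fun x ↦ 𝔷 x - 𝔷' x) y‖) (fun _ _ ↦ norm_nonneg _)
        (Finset.mem_range.2 (by omega))
    have hpartial : ∀ i' ≤ j, ∑ m ∈ Finset.range (i' + 1), ‖iteratedFDeriv ℝ m (fun x ↦ 𝔷 x - 𝔷' x) y‖ ≤ S := fun i' hi' ↦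
      Finset.sum_le_sum_of_subset_of_nonneg (Finset.range_mono (by omega)) fun _ _ _ ↦ norm_nonneg _
    refine (norm_iteratedFDeriv_fderiv_le_sum hc j y).trans ?_
    refine le_trans (Finset.sum_le_sum (g := fun a ↦ (C₁ a + L) * S) fun a _ ↦ ?_) ?_
    · -- the frame derivative of the difference
      show ‖iteratedFDeriv ℝ j (fun x ↦ fderiv ℝ (fun x ↦ jetComp G 𝔷 x - jetComp G 𝔷' x) x (e a)) y‖ ≤ (C₁ a + L) * S
      have hfun : (fun x ↦ fderiv ℝ (fun x ↦ jetComp G 𝔷 x - jetComp G 𝔷' x) x (e a)) = fun x ↦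
          (jetComp (GDv G (e a)) 𝔷 x - jetComp (GDv G (e a)) 𝔷' x) +
          ∑ k, ((jcoord k (fderiv ℝ 𝔷 x (e a)) - jcoord k (fderiv ℝ 𝔷' x (e a))) • jetComp (GDk G k) 𝔷 x +
            jcoord k (fderiv ℝ 𝔷' x (e a)) • (jetComp (GDk G k) 𝔷 x - jetComp (GDk G k) 𝔷' x)) := by
        funext x
        rw [fderiv_fun_sub ((contDiff_jetComp hG h𝔷).differentiable (by simp) x) ((contDiff_jetComp hG h𝔷').differentiable (by simp) x),
          FunLike.coe_sub, Pi.sub_apply, fderiv_jetComp_apply hG h𝔷, fderiv_jetComp_apply hG h𝔷']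
        have hk : ∑ k, ((jcoord k (fderiv ℝ 𝔷 x (e a)) - jcoord k (fderiv ℝ 𝔷' x (e a))) • jetComp (GDk G k) 𝔷 x +
            jcoord k (fderiv ℝ 𝔷' x (e a)) • (jetComp (GDk G k) 𝔷 x - jetComp (GDk G k) 𝔷' x)) =
            ∑ k, jcoord k (fderiv ℝ 𝔷 x (e a)) • jetComp (GDk G k) 𝔷 x - ∑ k, jcoord k (fderiv ℝ 𝔷' x (e a)) • jetComp (GDk G k) 𝔷' x := by
          rw [← Finset.sum_sub_distrib]
          exact Finset.sum_congr rfl fun k _ ↦ by rw [sub_smul, smul_sub]; abel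
        rw [hk]
        abel
      rw [hfun]
      have hD₁ : ContDiff ℝ ∞ fun x ↦ jetComp (GDv G (e a)) 𝔷 x - jetComp (GDv G (e a)) 𝔷' x :=
        (contDiff_jetComp (contDiff_GDv hG _) h𝔷).sub (contDiff_jetComp (contDiff_GDv hG _) h𝔷')
      have hPQ : ∀ k, ContDiff ℝ ∞ fun x ↦ (jcoord k (fderiv ℝ 𝔷 x (e a)) - jcoord k (fderiv ℝ 𝔷' x (e a))) • jetComp (GDk G k) 𝔷 x +
          jcoord k (fderiv ℝ 𝔷' x (e a)) • (jetComp (GDk G k) 𝔷 x - jetComp (GDk G k) 𝔷' x) := fun k ↦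
        (((hφ 𝔷 h𝔷 k a).sub (hφ 𝔷' h𝔷' k a)).smul (hψ 𝔷 h𝔷 k)).add ((hφ 𝔷' h𝔷' k a).smul ((hψ 𝔷 h𝔷 k).sub (hψ 𝔷' h𝔷' k)))
      have hSum : ContDiff ℝ ∞ fun x ↦ ∑ k, ((jcoord k (fderiv ℝ 𝔷 x (e a)) - jcoord k (fderiv ℝ 𝔷' x (e a))) • jetComp (GDk G k) 𝔷 x +
          jcoord k (fderiv ℝ 𝔷' x (e a)) • (jetComp (GDk G k) 𝔷 x - jetComp (GDk G k) 𝔷' x)) := ContDiff.sum fun k _ ↦ hPQ k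
      rw [fun_iteratedFDeriv_add_apply (hD₁.contDiffAt.of_le (by exact_mod_cast le_top)) (hSum.contDiffAt.of_le (by exact_mod_cast le_top)), add_mul]
      refine (norm_add_le _ _).trans (add_le_add ((hC₁ a h𝔷 h𝔷' hRj hRj' j le_rfl y).trans (mul_le_mul_of_nonneg_left (hpartial j le_rfl) (hC₁0 a))) ?_)
      have hPQ' : ∀ k, ContDiff ℝ j fun x ↦ (jcoord k (fderiv ℝ 𝔷 x (e a)) - jcoord k (fderiv ℝ 𝔷' x (e a))) • jetComp (GDk G k) 𝔷 x +
          jcoord k (fderiv ℝ 𝔷' x (e a)) • (jetComp (GDk G k) 𝔷 x - jetComp (GDk G k) 𝔷' x) := fun k ↦ (hPQ k).of_le (by exact_mod_cast le_top)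
      rw [iteratedFDeriv_sum (fun k _ ↦ hPQ' k), Finset.sum_apply, hL, Finset.sum_mul]
      refine (norm_sum_le _ _).trans (Finset.sum_le_sum fun k _ ↦ ?_)
      have hP : ContDiff ℝ ∞ fun x ↦ (jcoord k (fderiv ℝ 𝔷 x (e a)) - jcoord k (fderiv ℝ 𝔷' x (e a))) • jetComp (GDk G k) 𝔷 x :=
        ((hφ 𝔷 h𝔷 k a).sub (hφ 𝔷' h𝔷' k a)).smul (hψ 𝔷 h𝔷 k)
      have hQ : ContDiff ℝ ∞ fun x ↦ jcoord k (fderiv ℝ 𝔷' x (e a)) • (jetComp (GDk G k) 𝔷 x - jetComp (GDk G k) 𝔷' x) :=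
        (hφ 𝔷' h𝔷' k a).smul ((hψ 𝔷 h𝔷 k).sub (hψ 𝔷' h𝔷' k))
      rw [fun_iteratedFDeriv_add_apply (hP.contDiffAt.of_le (by exact_mod_cast le_top)) (hQ.contDiffAt.of_le (by exact_mod_cast le_top))]
      refine (norm_add_le _ _).trans ?_
      -- the coefficient difference is `jcoord k ∘ ∂_a(𝔷 - 𝔷')`
      have hcoef : ∀ i' ≤ j, ‖iteratedFDeriv ℝ i' (fun x ↦ jcoord k (fderiv ℝ 𝔷 x (e a)) - jcoord k (fderiv ℝ 𝔷' x (e a))) y‖ ≤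
          ‖(jcoord k : 𝒥 →L[ℝ] ℝ)‖ * S := by
        intro i' hi'
        have heq : (fun x ↦ jcoord k (fderiv ℝ 𝔷 x (e a)) - jcoord k (fderiv ℝ 𝔷' x (e a))) =
            (jcoord k) ∘ fun x ↦ fderiv ℝ (fun x ↦ 𝔷 x - 𝔷' x) x (e a) := by
          funext x
          simp only [Function.comp_apply, fderiv_fun_sub ((h𝔷.differentiable (by simp)) x) ((h𝔷'.differentiable (by simp)) x),
            FunLike.coe_sub, Pi.sub_apply, map_sub]
        rw [heq]
        have h1 := (jcoord k).norm_iteratedFDeriv_comp_left (f := fun x ↦ fderiv ℝ (fun x ↦ 𝔷 x - 𝔷' x) x (e a)) (x := y) (N := ∞) (n := i')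
          (((hd.fderiv_right (m := ∞) (by norm_cast)).clm_apply contDiff_const).contDiffAt) (by exact_mod_cast le_top)
        refine h1.trans (mul_le_mul_of_nonneg_left ?_ (norm_nonneg _))
        exact (norm_iteratedFDeriv_fderiv_frame_le hd i' a y).trans (hterm (i' + 1) (by omega))
      have hcoef' : ∀ i' ≤ j, ‖iteratedFDeriv ℝ i' (fun x ↦ jcoord k (fderiv ℝ 𝔷' x (e a))) y‖ ≤ ‖(jcoord k : 𝒥 →L[ℝ] ℝ)‖ * |R| := by
        intro i' hi'
        have h1 := (jcoord k).norm_iteratedFDeriv_comp_left (f := fun x ↦ fderiv ℝ 𝔷' x (e a)) (x := y) (N := ∞) (n := i')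
          (((h𝔷'.fderiv_right (m := ∞) (by norm_cast)).clm_apply contDiff_const).contDiffAt) (by exact_mod_cast le_top)
        refine h1.trans (mul_le_mul_of_nonneg_left ?_ (norm_nonneg _))
        exact (norm_iteratedFDeriv_fderiv_frame_le h𝔷' i' a y).trans ((hR' (i' + 1) (by omega) y).trans (le_abs_self R))
      refine (add_le_add (?_ : _ ≤ ‖(jcoord k : 𝒥 →L[ℝ] ℝ)‖ * (2 ^ j * C₃ k) * S) (?_ : _ ≤ ‖(jcoord k : 𝒥 →L[ℝ] ℝ)‖ * (2 ^ j * |R| * C₂ k) * S)).trans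
        (le_of_eq (by ring))
      · -- `P_k`
        refine (norm_iteratedFDeriv_smul_le ((hφ 𝔷 h𝔷 k a).sub (hφ 𝔷' h𝔷' k a)) (hψ 𝔷 h𝔷 k) y (n := j) (by exact_mod_cast le_top)).trans ?_
        calc ∑ i' ∈ Finset.range (j + 1), (j.choose i' : ℝ) * ‖iteratedFDeriv ℝ i' (fun x ↦ jcoord k (fderiv ℝ 𝔷 x (e a)) -
              jcoord k (fderiv ℝ 𝔷' x (e a))) y‖ * ‖iteratedFDeriv ℝ (j - i') (jetComp (GDk G k) 𝔷) y‖
            ≤ ∑ i' ∈ Finset.range (j + 1), (j.choose i' : ℝ) * (‖(jcoord k : 𝒥 →L[ℝ] ℝ)‖ * S) * C₃ k := by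
              refine Finset.sum_le_sum fun i' hi' ↦ ?_
              have hi'' : i' ≤ j := Nat.lt_succ_iff.1 (Finset.mem_range.1 hi')
              exact mul_le_mul (mul_le_mul_of_nonneg_left (hcoef i' hi'') (Nat.cast_nonneg _)) (hC₃ k h𝔷 hRj (j - i') (by omega) y)
                (norm_nonneg _) (mul_nonneg (Nat.cast_nonneg _) (mul_nonneg (norm_nonneg _) hS0))
          _ = ‖(jcoord k : 𝒥 →L[ℝ] ℝ)‖ * (2 ^ j * C₃ k) * S := by
              rw [← Finset.sum_mul, ← Finset.sum_mul]
              have h' : ∑ i' ∈ Finset.range (j + 1), (j.choose i' : ℝ) = 2 ^ j := by exact_mod_cast Nat.sum_range_choose j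
              rw [h']; ring
      · -- `Q_k`
        refine (norm_iteratedFDeriv_smul_le (hφ 𝔷' h𝔷' k a) ((hψ 𝔷 h𝔷 k).sub (hψ 𝔷' h𝔷' k)) y (n := j) (by exact_mod_cast le_top)).trans ?_
        calc ∑ i' ∈ Finset.range (j + 1), (j.choose i' : ℝ) * ‖iteratedFDeriv ℝ i' (fun x ↦ jcoord k (fderiv ℝ 𝔷' x (e a))) y‖ *
              ‖iteratedFDeriv ℝ (j - i') (fun x ↦ jetComp (GDk G k) 𝔷 x - jetComp (GDk G k) 𝔷' x) y‖
            ≤ ∑ i' ∈ Finset.range (j + 1), (j.choose i' : ℝ) * (‖(jcoord k : 𝒥 →L[ℝ] ℝ)‖ * |R|) * (C₂ k * S) := by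
              refine Finset.sum_le_sum fun i' hi' ↦ ?_
              have hi'' : i' ≤ j := Nat.lt_succ_iff.1 (Finset.mem_range.1 hi')
              refine mul_le_mul (mul_le_mul_of_nonneg_left (hcoef' i' hi'') (Nat.cast_nonneg _)) ?_ (norm_nonneg _)
                (mul_nonneg (Nat.cast_nonneg _) (mul_nonneg (norm_nonneg _) (abs_nonneg _)))
              exact (hC₂ k h𝔷 h𝔷' hRj hRj' (j - i') (by omega) y).trans (mul_le_mul_of_nonneg_left (hpartial _ (by omega)) (hC₂0 k))
          _ = ‖(jcoord k : 𝒥 →L[ℝ] ℝ)‖ * (2 ^ j * |R| * C₂ k) * S := by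
              rw [← Finset.sum_mul, ← Finset.sum_mul]
              have h' : ∑ i' ∈ Finset.range (j + 1), (j.choose i' : ℝ) = 2 ^ j := by exact_mod_cast Nat.sum_range_choose j
              rw [h']; ring
    · rw [← Finset.sum_mul]
      exact mul_le_mul_of_nonneg_right (le_add_of_nonneg_left hC₀0) hS0


/-! ### High–low `L²` bounds for composites -/

section Energy

variable [MeasurableSpace E'] [BorelSpace E']

omit [FiniteDimensional ℝ 𝒥] [NormedSpace ℝ 𝒥] [NormedSpace ℝ V] in
/-- The `L²` mass of a composite with a compactly supported `G`: `∫ ‖G(y, 𝔷 y)‖² ≤ M² vol(K)`, `K`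
the point-projection of the support of `G`, `‖G‖ ≤ M`. [folklore] -/
theorem lintegral_jetComp_sq_le {G : E' × 𝒥 → V} (hGc : HasCompactSupport G) {M : ℝ} (hM : ∀ p, ‖G p‖ ≤ M) (𝔷 : E' → 𝒥) :
    (∫⁻ y, ‖jetComp G 𝔷 y‖ₑ ^ 2) ≤ ENNReal.ofReal (M ^ 2) * volume (Prod.fst '' tsupport G) := by
  set K := Prod.fst '' tsupport G with hK
  have hKc : IsCompact K := hGc.image continuous_fst
  have hpt : ∀ y, ‖jetComp G 𝔷 y‖ₑ ^ 2 ≤ K.indicator (fun _ ↦ ENNReal.ofReal (M ^ 2)) y := by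
    intro y
    by_cases hy : y ∈ K
    · rw [indicator_of_mem hy]
      have h0 : 0 ≤ M := (norm_nonneg _).trans (hM (y, 𝔷 y))
      rw [jetComp_apply, ← ofReal_norm, ← ENNReal.ofReal_pow (norm_nonneg _)]
      exact ENNReal.ofReal_le_ofReal (pow_le_pow_left₀ (norm_nonneg _) (hM _) 2)
    · rw [indicator_of_notMem hy]
      have h0 : G (y, 𝔷 y) = 0 := image_eq_zero_of_notMem_tsupport fun h ↦ hy ⟨(y, 𝔷 y), h, rfl⟩
      simp [jetComp_apply, h0]
  calc (∫⁻ y, ‖jetComp G 𝔷 y‖ₑ ^ 2) ≤ ∫⁻ y, K.indicator (fun _ ↦ ENNReal.ofReal (M ^ 2)) y := lintegral_mono hpt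
    _ = ENNReal.ofReal (M ^ 2) * volume K := lintegral_indicator_const hKc.measurableSet _

/-- Energies of a jet coordinate of a field: `E_k((f)_k) ≤ C E_k(f)`. [folklore] -/
theorem sobolevEnergy_jcoord_comp_le (k : ℕ) :
    ∃ C : ℝ≥0∞, C ≠ ⊤ ∧ ∀ (kk : Fin (Module.finrank ℝ 𝒥)) {f : E' → 𝒥}, ContDiff ℝ ∞ f →
      sobolevEnergy k (fun x ↦ jcoord kk (f x)) ≤ C * sobolevEnergy k f := by
  obtain ⟨C, hCtop, hC⟩ := sobolevEnergy_clm_apply_le_crude (E := E') (F := 𝒥) (G := ℝ) k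
  set M : ℝ := ∑ kk : Fin (Module.finrank ℝ 𝒥), ‖(jcoord kk : 𝒥 →L[ℝ] ℝ)‖ with hM
  have hMk : ∀ kk, ‖(jcoord kk : 𝒥 →L[ℝ] ℝ)‖ ≤ M := fun kk ↦
    Finset.single_le_sum (f := fun kk ↦ ‖(jcoord kk : 𝒥 →L[ℝ] ℝ)‖) (fun _ _ ↦ norm_nonneg _) (Finset.mem_univ kk)
  refine ⟨C * ENNReal.ofReal (M ^ 2), ENNReal.mul_ne_top hCtop ENNReal.ofReal_ne_top, fun kk {f} hf ↦ ?_⟩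
  refine hC (B := fun _ ↦ jcoord kk) contDiff_const hf (fun _ ↦ hMk kk) fun l hl _ x ↦ ?_
  rw [iterDirDeriv_const_of_ne_nil _ (by simpa using hl)]
  simp only [Pi.zero_apply, norm_zero]
  exact (norm_nonneg _).trans (hMk kk)

omit [FiniteDimensional ℝ 𝒥] [MeasurableSpace E'] [BorelSpace E'] in
/-- The flipped scalar multiplication pairing has norm `≤ 1`. [folklore] -/
theorem norm_lsmul_flip_le : ‖((ContinuousLinearMap.lsmul ℝ ℝ : ℝ →L[ℝ] V →L[ℝ] V).flip)‖ ≤ 1 := by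
  rw [ContinuousLinearMap.opNorm_flip]; exact ContinuousLinearMap.opNorm_lsmul_le

/-- **High–low `L²` bounds for composites**: for smooth compactly supported `G`, every order `j`
and every `R` there is `C < ∞` such that for all smooth `𝔷` with `‖Dᵐ𝔷‖ ≤ R` only for
`m ≤ j/2 + 1`, `E_i(G∘(id, 𝔷)) ≤ C (1 + Σ_{m≤i} E_m(𝔷))` for all `i ≤ j`.
[cite: TaylorPDEIII2011, Ch. 13, Prop. 3.9] -/
theorem sobolevEnergy_jetComp_le :
    ∀ (j : ℕ) {G : E' × 𝒥 → V}, ContDiff ℝ ∞ G → HasCompactSupport G → ∀ R : ℝ,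
      ∃ C : ℝ≥0∞, C ≠ ⊤ ∧ ∀ {𝔷 : E' → 𝒥}, ContDiff ℝ ∞ 𝔷 → (∀ m ≤ j / 2 + 1, ∀ y, ‖iteratedFDeriv ℝ m 𝔷 y‖ ≤ R) →
        ∀ i ≤ j, sobolevEnergy i (jetComp G 𝔷) ≤ C * (1 + ∑ m ∈ Finset.range (i + 1), sobolevEnergy m 𝔷) := by
  intro j
  induction j with
  | zero =>
    intro G hG hGc R
    obtain ⟨M, hM0, hM⟩ := exists_bound_of_hasCompactSupport hG.continuous hGc
    have hKc : IsCompact (Prod.fst '' tsupport G) := hGc.image continuous_fst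
    refine ⟨ENNReal.ofReal (M ^ 2) * volume (Prod.fst '' tsupport G), ENNReal.mul_ne_top ENNReal.ofReal_ne_top hKc.measure_lt_top.ne,
      fun {𝔷} _ _ i hi ↦ ?_⟩
    obtain rfl : i = 0 := by omega
    rw [sobolevEnergy_zero_left]
    exact (lintegral_jetComp_sq_le hGc hM 𝔷).trans (le_mul_of_one_le_right' le_self_add)
  | succ j ih =>
    intro G hG hGc R
    set n : ℕ := Module.finrank ℝ E' with hn
    set nJ : ℕ := Module.finrank ℝ 𝒥 with hnJ
    -- the constants
    obtain ⟨Cg, hCgtop, hCg⟩ := ih hG hGc R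
    have h1 := fun a ↦ ih (contDiff_GDv hG (stdOrthonormalBasis ℝ E' a)) (hasCompactSupport_GDv hGc (stdOrthonormalBasis ℝ E' a)) R
    have h2 := fun k ↦ ih (contDiff_GDk hG k) (hasCompactSupport_GDk hGc k) R
    have h3 := fun k ↦ norm_iteratedFDeriv_jetComp_le (j / 2) (contDiff_GDk hG k) (hasCompactSupport_GDk hGc k) R
    choose Cv hCvtop hCv using h1
    choose Ck hCktop hCk using h2
    choose Ca hCa0 hCa using h3
    have h4 := fun m : Fin (j + 1) ↦ sobolevEnergy_jcoord_comp_le (E' := E') (𝒥 := 𝒥) (m : ℕ)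
    choose Ccl hCcltop hCcl using h4
    set Ccl' : ℝ≥0∞ := ∑ m : Fin (j + 1), Ccl m with hCcl'
    have hCcl'top : Ccl' ≠ ⊤ := ENNReal.sum_ne_top.2 fun m _ ↦ hCcltop m
    have hCclm : ∀ m (hm : m ≤ j), ∀ (kk : Fin nJ) {f : E' → 𝒥}, ContDiff ℝ ∞ f → sobolevEnergy m (fun x ↦ jcoord kk (f x)) ≤ Ccl' * sobolevEnergy m f := by
      intro m hm kk f hf
      refine (hCcl ⟨m, by omega⟩ kk hf).trans (mul_le_mul' ?_ le_rfl)
      exact Finset.single_le_sum (f := Ccl) (fun _ _ ↦ bot_le) (Finset.mem_univ _)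
    obtain ⟨Chl, hChltop, hChl⟩ := sobolevEnergy_bilinear_highlow (E := E') (G₁ := V) (G₂ := ℝ) (F := V) j
    obtain ⟨M₀, hM₀0, hM₀⟩ := exists_bound_of_hasCompactSupport hG.continuous hGc
    have hKc : IsCompact (Prod.fst '' tsupport G) := hGc.image continuous_fst
    set Z : ℝ≥0∞ := ENNReal.ofReal (M₀ ^ 2) * volume (Prod.fst '' tsupport G) with hZ
    have hZtop : Z ≠ ⊤ := ENNReal.mul_ne_top ENNReal.ofReal_ne_top hKc.measure_lt_top.ne
    set h : ℕ := j / 2 + 1 with hh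
    -- per-`(a, k)` constant of the product term
    set Dk : Fin nJ → ℝ≥0∞ := fun k ↦ Chl * ((h : ℝ≥0∞) * ENNReal.ofReal (Ca k ^ 2) * Ccl' +
      ENNReal.ofReal ((‖(jcoord k : 𝒥 →L[ℝ] ℝ)‖ * |R|) ^ 2) * ((j + 1 : ℕ) : ℝ≥0∞) * Ck k) with hDk
    have hDktop : ∀ k, Dk k ≠ ⊤ := fun k ↦ ENNReal.mul_ne_top hChltop (ENNReal.add_ne_top.2
      ⟨ENNReal.mul_ne_top (ENNReal.mul_ne_top (ENNReal.natCast_ne_top _) ENNReal.ofReal_ne_top) hCcl'top,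
       ENNReal.mul_ne_top (ENNReal.mul_ne_top ENNReal.ofReal_ne_top (ENNReal.natCast_ne_top _)) (hCktop k)⟩)
    set Da : Fin n → ℝ≥0∞ := fun a ↦ 2 * Cv a + 2 * (nJ : ℝ≥0∞) * ∑ k, Dk k with hDa
    have hDatop : ∀ a, Da a ≠ ⊤ := fun a ↦ ENNReal.add_ne_top.2 ⟨ENNReal.mul_ne_top (by simp) (hCvtop a),
      ENNReal.mul_ne_top (ENNReal.mul_ne_top (by simp) (ENNReal.natCast_ne_top _)) (ENNReal.sum_ne_top.2 fun k _ ↦ hDktop k)⟩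
    refine ⟨Cg + Z + ∑ a, Da a, ENNReal.add_ne_top.2 ⟨ENNReal.add_ne_top.2 ⟨hCgtop, hZtop⟩, ENNReal.sum_ne_top.2 fun a _ ↦ hDatop a⟩,
      fun {𝔷} h𝔷 hR i hi ↦ ?_⟩
    rcases Nat.lt_or_ge i (j + 1) with hij | hij
    · refine (hCg h𝔷 (fun m hm y ↦ hR m (le_trans hm (by omega)) y) i (by omega)).trans (mul_le_mul' ?_ le_rfl)
      exact le_add_right le_self_add
    obtain rfl : i = j + 1 := by omega
    set T : ℝ≥0∞ := ∑ m ∈ Finset.range (j + 1 + 1), sobolevEnergy m 𝔷 with hT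
    have hTm : ∀ m ≤ j + 1, sobolevEnergy m 𝔷 ≤ T := fun m hm ↦
      Finset.single_le_sum (f := fun m ↦ sobolevEnergy m 𝔷) (fun _ _ ↦ bot_le) (Finset.mem_range.2 (by omega))
    have hTpart : ∀ i' ≤ j + 1, ∑ m ∈ Finset.range (i' + 1), sobolevEnergy m 𝔷 ≤ T := fun i' hi' ↦
      Finset.sum_le_sum_of_subset_of_nonneg (Finset.range_mono (by omega)) fun _ _ _ ↦ bot_le
    -- hypotheses at the orders used below
    have hRa : ∀ m ≤ j / 2, ∀ y, ‖iteratedFDeriv ℝ m 𝔷 y‖ ≤ R := fun m hm y ↦ hR m (by omega) y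
    have hRih : ∀ m ≤ j / 2 + 1, ∀ y, ‖iteratedFDeriv ℝ m 𝔷 y‖ ≤ R := fun m hm y ↦ hR m (by omega) y
    -- smoothness
    have hc : ContDiff ℝ ∞ (jetComp G 𝔷) := contDiff_jetComp hG h𝔷
    have hφ : ∀ k a, ContDiff ℝ ∞ fun x ↦ jcoord k (fderiv ℝ 𝔷 x (stdOrthonormalBasis ℝ E' a)) := fun k a ↦
      (jcoord k).contDiff.comp ((h𝔷.fderiv_right (m := ∞) (by norm_cast)).clm_apply contDiff_const)
    have hψ : ∀ k, ContDiff ℝ ∞ (jetComp (GDk G k) 𝔷) := fun k ↦ contDiff_jetComp (contDiff_GDk hG _) h𝔷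
    have hA : ∀ a, ContDiff ℝ ∞ (jetComp (GDv G (stdOrthonormalBasis ℝ E' a)) 𝔷) := fun a ↦ contDiff_jetComp (contDiff_GDv hG _) h𝔷
    -- the product terms
    have hprod : ∀ k a, sobolevEnergy j (fun x ↦ jcoord k (fderiv ℝ 𝔷 x (stdOrthonormalBasis ℝ E' a)) • jetComp (GDk G k) 𝔷 x) ≤ Dk k * (1 + T) := by
      intro k a
      set B := ((ContinuousLinearMap.lsmul ℝ ℝ : ℝ →L[ℝ] V →L[ℝ] V).flip) with hB
      have hfun : (fun x ↦ jcoord k (fderiv ℝ 𝔷 x (stdOrthonormalBasis ℝ E' a)) • jetComp (GDk G k) 𝔷 x) = fun x ↦ B (jetComp (GDk G k) 𝔷 x) (jcoord k (fderiv ℝ 𝔷 x (stdOrthonormalBasis ℝ E' a))) := by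
        funext x; simp [hB]
      rw [hfun]
      have hM : ∀ i' < h, ∀ y, ‖iteratedFDeriv ℝ i' (jetComp (GDk G k) 𝔷) y‖ ≤ Ca k := fun i' hi' y ↦ hCa k h𝔷 hRa i' (by omega) y
      have hN0 : 0 ≤ ‖(jcoord k : 𝒥 →L[ℝ] ℝ)‖ * |R| := by positivity
      have hN : ∀ m, m + h ≤ j → ∀ y, ‖iteratedFDeriv ℝ m (fun x ↦ jcoord k (fderiv ℝ 𝔷 x (stdOrthonormalBasis ℝ E' a))) y‖ ≤ ‖(jcoord k : 𝒥 →L[ℝ] ℝ)‖ * |R| := by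
        intro m hm y
        have h1 := (jcoord k).norm_iteratedFDeriv_comp_left (f := fun x ↦ fderiv ℝ 𝔷 x (stdOrthonormalBasis ℝ E' a)) (x := y) (N := ∞) (n := m)
          (((h𝔷.fderiv_right (m := ∞) (by norm_cast)).clm_apply contDiff_const).contDiffAt) (by exact_mod_cast le_top)
        refine h1.trans (mul_le_mul_of_nonneg_left ?_ (norm_nonneg _))
        exact (norm_iteratedFDeriv_fderiv_frame_le h𝔷 m a y).trans ((hR (m + 1) (by omega) y).trans (le_abs_self R))
      have hhl := hChl B (hψ k) (hφ k a) (h := h) (by omega) (Mφ := fun _ ↦ Ca k) hM hN0 hN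
      rw [highLowQ_eq] at hhl
      refine hhl.trans ?_
      have hB1 : ENNReal.ofReal (‖B‖ ^ 2) ≤ 1 := by
        rw [← ENNReal.ofReal_one]
        refine ENNReal.ofReal_le_ofReal ?_
        have h := norm_lsmul_flip_le (V := V)
        rw [← hB] at h
        nlinarith [norm_nonneg B]
      -- the sup part: coordinate energies of `∂_a 𝔷`
      have hsup : ∑ i' ∈ Finset.range h, ENNReal.ofReal (Ca k ^ 2) * sobolevEnergy (j - i') (fun x ↦ jcoord k (fderiv ℝ 𝔷 x (stdOrthonormalBasis ℝ E' a))) ≤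
          (h : ℝ≥0∞) * ENNReal.ofReal (Ca k ^ 2) * Ccl' * T := by
        calc _ ≤ ∑ _i' ∈ Finset.range h, ENNReal.ofReal (Ca k ^ 2) * (Ccl' * T) := by
              refine Finset.sum_le_sum fun i' hi' ↦ mul_le_mul' le_rfl ?_
              have hi'' : i' < h := Finset.mem_range.1 hi'
              refine (hCclm (j - i') (by omega) k ((h𝔷.fderiv_right (m := ∞) (by norm_cast)).clm_apply contDiff_const)).trans ?_
              refine mul_le_mul' le_rfl ?_
              calc sobolevEnergy (j - i') (fun x ↦ fderiv ℝ 𝔷 x (stdOrthonormalBasis ℝ E' a))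
                  ≤ ∑ a', sobolevEnergy (j - i') (fun x ↦ fderiv ℝ 𝔷 x (stdOrthonormalBasis ℝ E' a')) :=
                    Finset.single_le_sum (f := fun a' ↦ sobolevEnergy (j - i') (fun x ↦ fderiv ℝ 𝔷 x (stdOrthonormalBasis ℝ E' a'))) (fun _ _ ↦ bot_le) (Finset.mem_univ a)
                _ ≤ sobolevEnergy (j - i' + 1) 𝔷 := sum_sobolevEnergy_fderiv_frame_le _ 𝔷
                _ ≤ T := hTm _ (by omega)
          _ = (h : ℝ≥0∞) * ENNReal.ofReal (Ca k ^ 2) * Ccl' * T := by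
              rw [Finset.sum_const, Finset.card_range, nsmul_eq_mul]; ring
      -- the `L²` part: energies of the composite by the induction hypothesis
      have hL2 : ENNReal.ofReal ((‖(jcoord k : 𝒥 →L[ℝ] ℝ)‖ * |R|) ^ 2) * ∑ i' ∈ Finset.Ico h (j + 1), sobolevEnergy i' (jetComp (GDk G k) 𝔷) ≤
          ENNReal.ofReal ((‖(jcoord k : 𝒥 →L[ℝ] ℝ)‖ * |R|) ^ 2) * ((j + 1 : ℕ) : ℝ≥0∞) * Ck k * (1 + T) := by
        rw [mul_assoc, mul_assoc]
        refine mul_le_mul' le_rfl ?_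
        calc ∑ i' ∈ Finset.Ico h (j + 1), sobolevEnergy i' (jetComp (GDk G k) 𝔷)
            ≤ ∑ _i' ∈ Finset.Ico h (j + 1), Ck k * (1 + T) := by
              refine Finset.sum_le_sum fun i' hi' ↦ ?_
              have hi'' : i' ≤ j := Nat.lt_succ_iff.1 (Finset.mem_Ico.1 hi').2
              exact (hCk k h𝔷 hRih i' hi'').trans (mul_le_mul' le_rfl (add_le_add le_rfl (hTpart i' (by omega))))
          _ ≤ ((j + 1 : ℕ) : ℝ≥0∞) * (Ck k * (1 + T)) := by
              rw [Finset.sum_const, nsmul_eq_mul]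
              refine mul_le_mul' ?_ le_rfl
              have hcard : (Finset.Ico h (j + 1)).card ≤ j + 1 := by rw [Nat.card_Ico]; omega
              exact_mod_cast hcard
          _ = _ := by ring
      calc Chl * ENNReal.ofReal (‖B‖ ^ 2) * ((∑ i' ∈ Finset.range h, ENNReal.ofReal (Ca k ^ 2) * sobolevEnergy (j - i') (fun x ↦ jcoord k (fderiv ℝ 𝔷 x (stdOrthonormalBasis ℝ E' a)))) +
            ENNReal.ofReal ((‖(jcoord k : 𝒥 →L[ℝ] ℝ)‖ * |R|) ^ 2) * ∑ i' ∈ Finset.Ico h (j + 1), sobolevEnergy i' (jetComp (GDk G k) 𝔷))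
          ≤ Chl * 1 * ((h : ℝ≥0∞) * ENNReal.ofReal (Ca k ^ 2) * Ccl' * T +
              ENNReal.ofReal ((‖(jcoord k : 𝒥 →L[ℝ] ℝ)‖ * |R|) ^ 2) * ((j + 1 : ℕ) : ℝ≥0∞) * Ck k * (1 + T)) :=
            mul_le_mul' (mul_le_mul' le_rfl hB1) (add_le_add hsup hL2)
        _ ≤ Chl * ((h : ℝ≥0∞) * ENNReal.ofReal (Ca k ^ 2) * Ccl' * (1 + T) +
              ENNReal.ofReal ((‖(jcoord k : 𝒥 →L[ℝ] ℝ)‖ * |R|) ^ 2) * ((j + 1 : ℕ) : ℝ≥0∞) * Ck k * (1 + T)) := by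
            rw [mul_one]
            exact mul_le_mul' le_rfl (add_le_add (mul_le_mul' le_rfl le_add_self) le_rfl)
        _ = Dk k * (1 + T) := by simp only [hDk]; ring
    -- the frame derivatives of the composite
    have hFa : ∀ a, sobolevEnergy j (fun x ↦ fderiv ℝ (jetComp G 𝔷) x (stdOrthonormalBasis ℝ E' a)) ≤ Da a * (1 + T) := by
      intro a
      have hfun : (fun x ↦ fderiv ℝ (jetComp G 𝔷) x (stdOrthonormalBasis ℝ E' a)) = fun x ↦ jetComp (GDv G (stdOrthonormalBasis ℝ E' a)) 𝔷 x +
          ∑ k, jcoord k (fderiv ℝ 𝔷 x (stdOrthonormalBasis ℝ E' a)) • jetComp (GDk G k) 𝔷 x := funext fun x ↦ fderiv_jetComp_apply hG h𝔷 x _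
      rw [hfun]
      have hS : ContDiff ℝ j fun x ↦ ∑ k, jcoord k (fderiv ℝ 𝔷 x (stdOrthonormalBasis ℝ E' a)) • jetComp (GDk G k) 𝔷 x :=
        ContDiff.sum fun k _ ↦ ((hφ k a).smul (hψ k)).of_le (by exact_mod_cast le_top)
      refine (sobolevEnergy_add_le j ((hA a).of_le (by exact_mod_cast le_top)) hS).trans ?_
      have h1 : sobolevEnergy j (jetComp (GDv G (stdOrthonormalBasis ℝ E' a)) 𝔷) ≤ Cv a * (1 + T) :=
        (hCv a h𝔷 hRih j le_rfl).trans (mul_le_mul' le_rfl (add_le_add le_rfl (hTpart j (by omega))))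
      have h2 : sobolevEnergy j (fun x ↦ ∑ k, jcoord k (fderiv ℝ 𝔷 x (stdOrthonormalBasis ℝ E' a)) • jetComp (GDk G k) 𝔷 x) ≤ (nJ : ℝ≥0∞) * ∑ k, Dk k * (1 + T) := by
        refine (sobolevEnergy_sum_le_card j Finset.univ fun k _ ↦ ((hφ k a).smul (hψ k)).of_le (by exact_mod_cast le_top)).trans ?_
        rw [Finset.card_univ, Fintype.card_fin]
        exact mul_le_mul' le_rfl (Finset.sum_le_sum fun k _ ↦ hprod k a)
      calc 2 * sobolevEnergy j (jetComp (GDv G (stdOrthonormalBasis ℝ E' a)) 𝔷) + 2 * sobolevEnergy j (fun x ↦ ∑ k, jcoord k (fderiv ℝ 𝔷 x (stdOrthonormalBasis ℝ E' a)) • jetComp (GDk G k) 𝔷 x)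
          ≤ 2 * (Cv a * (1 + T)) + 2 * ((nJ : ℝ≥0∞) * ∑ k, Dk k * (1 + T)) := add_le_add (mul_le_mul' le_rfl h1) (mul_le_mul' le_rfl h2)
        _ = Da a * (1 + T) := by rw [hDa, ← Finset.sum_mul]; ring
    -- assemble
    rw [sobolevEnergy_succ]
    calc (∫⁻ x, ‖jetComp G 𝔷 x‖ₑ ^ 2) + ∑ a, sobolevEnergy j (fun x ↦ fderiv ℝ (jetComp G 𝔷) x (stdOrthonormalBasis ℝ E' a))
        ≤ Z + ∑ a, Da a * (1 + T) := add_le_add (lintegral_jetComp_sq_le hGc hM₀ 𝔷) (Finset.sum_le_sum fun a _ ↦ hFa a)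
      _ ≤ (Cg + Z + ∑ a, Da a) * (1 + T) := by
          rw [← Finset.sum_mul, add_mul]
          refine add_le_add ?_ le_rfl
          exact (le_mul_of_one_le_right' le_self_add).trans (mul_le_mul' le_add_self le_rfl)

end Energy

end Literature.Analysis.PDE
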